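import Mathlib
import Summits.PneNP.PneNP.Theses.OverlapGapAlgebra
import Summits.PneNP.PneNP.Theorems.OverlapGapAlgebraPositiveSatProbability
import Summits.PneNP.PneNP.Theorems.OverlapGapAlgebraSearchHardWindowComposition
import Summits.PneNP.PneNP.Theorems.OverlapGapAlgebraSearchHardWindowEnsembleOGPHolds
import Summits.PneNP.PneNP.Theorems.OverlapGapAlgebraSearchHardWindowCore
import Summits.PneNP.PneNP.Theorems.SearchHardWindow.Negative.FalseWithoutPolyTime

/-!
# `SearchHardWindow` (crux stmt-PneNP-2460), line `Sketch` / Line A: the kernel IS the core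

Reduction certificate of the continuation lead c3 (`prover-line-stmt-PneNP-2460-c3-0`, 2026-08-16).
The skeleton `Cruxes/SearchHardWindow/Lines/Sketch.lean` (v15) has exactly one `sorry`, the kernel
`stub_polyTimeLowDegreeSimulable` ("a polynomial-time `f` solving `F_k(n, ⌊α_k n⌋)` with probability
`≥ ε` infinitely often is shadowed by a saturated coordinate-degree-`o(n)` function of bounded energy
sign-solving `≥ ε/2` of the instances infinitely often", `α_k = 5 · 2^k log k / k`).  Every other
ingredient of the line is a theorem of the tree: Huang–Sellke's strong low-degree hardness
`huangSellke2025KSat_holds` (arXiv:2501.06427 Cor. 3.21, landed by leads c0–c2), uniformly positive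
satisfiability `positiveSatProbability_proof` (Achlioptas–Peres 2004), the composition
`stub_lineAComposition`, and the strength certificate `searchHardWindow_implies_pneNP`.

This file records, sorry-free and WITHOUT any hypothesis other than the kernel / the core themselves,
that the open stub is not a lemma of the line but the crux's own residual core
`H k` := "every `IsPolyTime f` solves `F_k(n, ⌊α_k n⌋)` with probability `→ 0`":

* `shwK_searchHardWindow_of_kernel` : kernel `→ SearchHardWindow` (the line, now unconditional in
  everything but the kernel);
* `shwK_pneNP_of_kernel`            : kernel `→ PneNP` (the kernel is summit-strength);
* `shwK_kernelAt_of_hardAt`         : `H k →` kernel at `k` (vacuously: under `H k` no poly-time `f`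
  succeeds frequently — `kernelHypothesis_false_of_hardness` of the disprover's Negative file);
* `shwK_kernel_of_hard`             : `(∀ k ≥ 3, H k) →` kernel;
* `shwK_hardAt_of_kernelAt`         : for `k ≥ k₀` (Huang–Sellke's threshold), kernel at `k → H k`;
* `shwK_kernelAt_iff_hardAt`        : `∃ k₀, ∀ k ≥ k₀, (kernel at k ↔ H k)`.

So for all large `k` the stub is EQUIVALENT to `H k`, and `H k` for one `k ≥ 1024` already gives the
crux (`searchHardWindow_of_hard_at_window`) and hence `PneNP`: no proof obligation of line `Sketch`
is easier than the crux itself (outcome `promote-stub`).  The statements are spelled with the literal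
sub-formulas of the route decl and of the registered stub (same binders, same `open scoped Classical`
context as `Theorems/OverlapGapAlgebraSearchHardWindowComposition.lean`).
-/

-- `Summit.PneNP.PneNP.…` is the tree's mandated namespace (summit = sub-problem name, D-0017).
set_option linter.dupNamespace false

noncomputable section

namespace Summit.PneNP.PneNP.Theorems

open Finset Filter Asymptotics
open Literature.Computability.Complexity
open Summit.PneNP.PneNP.Theses.OverlapGapAlgebra
open scoped Classical

/-- **The line, unconditional but for the kernel.** The kernel `stub_polyTimeLowDegreeSimulable`
of line `Sketch` alone implies `SearchHardWindow`: `stub_lineAComposition` fed with the landed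
`huangSellke2025KSat_holds` (HS25 Cor. 3.21) and `positiveSatProbability_proof` (AP04).
[HuangSellke2025 = arXiv:2501.06427, Cor. 3.21; AchlioptasPeres2004, Thm. 2] -/
theorem shwK_searchHardWindow_of_kernel
    (hKER : ∀ k : ℕ, 3 ≤ k → ∀ f : List Bool → List Bool, IsPolyTime f → ∀ ε : ℝ, 0 < ε →
      (∃ᶠ n : ℕ in atTop, ∀ m : ℕ, m = ⌊5 * 2 ^ k * Real.log k / k * n⌋₊ →
      ε * Fintype.card (Fin m → Fin k → Fin n × Bool) ≤
      ((univ.filter fun Φ : Fin m → Fin k → Fin n × Bool => ∀ i, ∃ j,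
      (f (encodingCNF.encode (List.ofFn fun a => List.ofFn fun b =>
      (((Φ a b).1 : ℕ), (Φ a b).2)))).getD (Φ i j).1 false = (Φ i j).2).card : ℝ)) →
      ∃ C : ℝ, 0 < C ∧ ∃ D : ℕ → ℕ, (fun n : ℕ => (D n : ℝ)) =o[atTop] (fun n : ℕ => (n : ℝ)) ∧
      ∃ F : (n : ℕ) → (m : ℕ) → (Fin m → Fin k → Fin n × Bool) → Fin n → ℝ,
      (∀ (n m : ℕ) (v : Fin n), IsCoordDegreeLE (D n)
      (fun y : Fin m × Fin k → Fin n × Bool => F n m (Function.curry y) v)) ∧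
      (∀ n m : ℕ, m = ⌊5 * 2 ^ k * Real.log k / k * n⌋₊ →
      ∑ Φ : Fin m → Fin k → Fin n × Bool, ∑ v : Fin n, F n m Φ v ^ 2
      ≤ C * n * Fintype.card (Fin m → Fin k → Fin n × Bool)) ∧
      ∃ᶠ n : ℕ in atTop, ∀ m : ℕ, m = ⌊5 * 2 ^ k * Real.log k / k * n⌋₊ →
      ε / 2 * Fintype.card (Fin m → Fin k → Fin n × Bool) ≤
      ((univ.filter fun Φ : Fin m → Fin k → Fin n × Bool =>
      (∀ v : Fin n, 1 ≤ |F n m Φ v|) ∧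
      ∀ i : Fin m, ∃ j : Fin k, decide (0 ≤ F n m Φ (Φ i j).1) = (Φ i j).2).card : ℝ)) :
    SearchHardWindow :=
  stub_lineAComposition huangSellke2025KSat_holds hKER positiveSatProbability_proof

/-- **The kernel is summit-strength.** The kernel of line `Sketch` implies `PneNP`
(`shwK_searchHardWindow_of_kernel` composed with `searchHardWindow_implies_pneNP`).
[AroraBarakCC2009, Thm. 2.18] -/
theorem shwK_pneNP_of_kernel
    (hKER : ∀ k : ℕ, 3 ≤ k → ∀ f : List Bool → List Bool, IsPolyTime f → ∀ ε : ℝ, 0 < ε →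
      (∃ᶠ n : ℕ in atTop, ∀ m : ℕ, m = ⌊5 * 2 ^ k * Real.log k / k * n⌋₊ →
      ε * Fintype.card (Fin m → Fin k → Fin n × Bool) ≤
      ((univ.filter fun Φ : Fin m → Fin k → Fin n × Bool => ∀ i, ∃ j,
      (f (encodingCNF.encode (List.ofFn fun a => List.ofFn fun b =>
      (((Φ a b).1 : ℕ), (Φ a b).2)))).getD (Φ i j).1 false = (Φ i j).2).card : ℝ)) →
      ∃ C : ℝ, 0 < C ∧ ∃ D : ℕ → ℕ, (fun n : ℕ => (D n : ℝ)) =o[atTop] (fun n : ℕ => (n : ℝ)) ∧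
      ∃ F : (n : ℕ) → (m : ℕ) → (Fin m → Fin k → Fin n × Bool) → Fin n → ℝ,
      (∀ (n m : ℕ) (v : Fin n), IsCoordDegreeLE (D n)
      (fun y : Fin m × Fin k → Fin n × Bool => F n m (Function.curry y) v)) ∧
      (∀ n m : ℕ, m = ⌊5 * 2 ^ k * Real.log k / k * n⌋₊ →
      ∑ Φ : Fin m → Fin k → Fin n × Bool, ∑ v : Fin n, F n m Φ v ^ 2
      ≤ C * n * Fintype.card (Fin m → Fin k → Fin n × Bool)) ∧
      ∃ᶠ n : ℕ in atTop, ∀ m : ℕ, m = ⌊5 * 2 ^ k * Real.log k / k * n⌋₊ →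
      ε / 2 * Fintype.card (Fin m → Fin k → Fin n × Bool) ≤
      ((univ.filter fun Φ : Fin m → Fin k → Fin n × Bool =>
      (∀ v : Fin n, 1 ≤ |F n m Φ v|) ∧
      ∀ i : Fin m, ∃ j : Fin k, decide (0 ≤ F n m Φ (Φ i j).1) = (Φ i j).2).card : ℝ)) :
    _root_.PneNP :=
  searchHardWindow_implies_pneNP (shwK_searchHardWindow_of_kernel hKER)

/-- **Core ⇒ kernel, at each `k`.** If every polynomial-time `f` solves `F_k(n, ⌊α_k n⌋)` with
probability `→ 0` (the hardness conjunct `H k` of the crux at the window density), then the kernel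
holds at `k` VACUOUSLY: its hypothesis (frequent success `≥ ε`) is never met
(`kernelHypothesis_false_of_hardness`). [BreslerHuang2022 = arXiv:2106.02129, Conj. 2.7 (context)] -/
theorem shwK_kernelAt_of_hardAt {k : ℕ}
    (hH : ∀ f : List Bool → List Bool, IsPolyTime f → ∀ ε : ℝ, 0 < ε →
      ∀ᶠ n : ℕ in atTop, ∀ m : ℕ, m = ⌊5 * 2 ^ k * Real.log k / k * n⌋₊ →
      ((univ.filter fun Φ : Fin m → Fin k → Fin n × Bool => ∀ i, ∃ j,
      (f (encodingCNF.encode (List.ofFn fun a => List.ofFn fun b =>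
      (((Φ a b).1 : ℕ), (Φ a b).2)))).getD (Φ i j).1 false = (Φ i j).2).card : ℝ) /
      Fintype.card (Fin m → Fin k → Fin n × Bool) ≤ ε) :
    ∀ f : List Bool → List Bool, IsPolyTime f → ∀ ε : ℝ, 0 < ε →
    (∃ᶠ n : ℕ in atTop, ∀ m : ℕ, m = ⌊5 * 2 ^ k * Real.log k / k * n⌋₊ →
    ε * Fintype.card (Fin m → Fin k → Fin n × Bool) ≤
    ((univ.filter fun Φ : Fin m → Fin k → Fin n × Bool => ∀ i, ∃ j,
    (f (encodingCNF.encode (List.ofFn fun a => List.ofFn fun b =>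
    (((Φ a b).1 : ℕ), (Φ a b).2)))).getD (Φ i j).1 false = (Φ i j).2).card : ℝ)) →
    ∃ C : ℝ, 0 < C ∧ ∃ D : ℕ → ℕ, (fun n : ℕ => (D n : ℝ)) =o[atTop] (fun n : ℕ => (n : ℝ)) ∧
    ∃ F : (n : ℕ) → (m : ℕ) → (Fin m → Fin k → Fin n × Bool) → Fin n → ℝ,
    (∀ (n m : ℕ) (v : Fin n), IsCoordDegreeLE (D n)
    (fun y : Fin m × Fin k → Fin n × Bool => F n m (Function.curry y) v)) ∧
    (∀ n m : ℕ, m = ⌊5 * 2 ^ k * Real.log k / k * n⌋₊ →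
    ∑ Φ : Fin m → Fin k → Fin n × Bool, ∑ v : Fin n, F n m Φ v ^ 2
    ≤ C * n * Fintype.card (Fin m → Fin k → Fin n × Bool)) ∧
    ∃ᶠ n : ℕ in atTop, ∀ m : ℕ, m = ⌊5 * 2 ^ k * Real.log k / k * n⌋₊ →
    ε / 2 * Fintype.card (Fin m → Fin k → Fin n × Bool) ≤
    ((univ.filter fun Φ : Fin m → Fin k → Fin n × Bool =>
    (∀ v : Fin n, 1 ≤ |F n m Φ v|) ∧
    ∀ i : Fin m, ∃ j : Fin k, decide (0 ≤ F n m Φ (Φ i j).1) = (Φ i j).2).card : ℝ) := by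
  intro f hf ε hε hfreq
  exact (SearchHardWindow.Negative.kernelHypothesis_false_of_hardness
    (k := k) (α := 5 * 2 ^ k * Real.log k / k) hH hf hε hfreq).elim

/-- **Core ⇒ kernel.** The hardness conjunct at `(k, α_k)` for every `k ≥ 3` gives the kernel of
line `Sketch` verbatim (vacuously at each `k`). [BreslerHuang2022 = arXiv:2106.02129, Conj. 2.7 (context)] -/
theorem shwK_kernel_of_hard
    (hH : ∀ k : ℕ, 3 ≤ k → ∀ f : List Bool → List Bool, IsPolyTime f → ∀ ε : ℝ, 0 < ε →
      ∀ᶠ n : ℕ in atTop, ∀ m : ℕ, m = ⌊5 * 2 ^ k * Real.log k / k * n⌋₊ →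
      ((univ.filter fun Φ : Fin m → Fin k → Fin n × Bool => ∀ i, ∃ j,
      (f (encodingCNF.encode (List.ofFn fun a => List.ofFn fun b =>
      (((Φ a b).1 : ℕ), (Φ a b).2)))).getD (Φ i j).1 false = (Φ i j).2).card : ℝ) /
      Fintype.card (Fin m → Fin k → Fin n × Bool) ≤ ε) :
    ∀ k : ℕ, 3 ≤ k → ∀ f : List Bool → List Bool, IsPolyTime f → ∀ ε : ℝ, 0 < ε →
    (∃ᶠ n : ℕ in atTop, ∀ m : ℕ, m = ⌊5 * 2 ^ k * Real.log k / k * n⌋₊ →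
    ε * Fintype.card (Fin m → Fin k → Fin n × Bool) ≤
    ((univ.filter fun Φ : Fin m → Fin k → Fin n × Bool => ∀ i, ∃ j,
    (f (encodingCNF.encode (List.ofFn fun a => List.ofFn fun b =>
    (((Φ a b).1 : ℕ), (Φ a b).2)))).getD (Φ i j).1 false = (Φ i j).2).card : ℝ)) →
    ∃ C : ℝ, 0 < C ∧ ∃ D : ℕ → ℕ, (fun n : ℕ => (D n : ℝ)) =o[atTop] (fun n : ℕ => (n : ℝ)) ∧
    ∃ F : (n : ℕ) → (m : ℕ) → (Fin m → Fin k → Fin n × Bool) → Fin n → ℝ,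
    (∀ (n m : ℕ) (v : Fin n), IsCoordDegreeLE (D n)
    (fun y : Fin m × Fin k → Fin n × Bool => F n m (Function.curry y) v)) ∧
    (∀ n m : ℕ, m = ⌊5 * 2 ^ k * Real.log k / k * n⌋₊ →
    ∑ Φ : Fin m → Fin k → Fin n × Bool, ∑ v : Fin n, F n m Φ v ^ 2
    ≤ C * n * Fintype.card (Fin m → Fin k → Fin n × Bool)) ∧
    ∃ᶠ n : ℕ in atTop, ∀ m : ℕ, m = ⌊5 * 2 ^ k * Real.log k / k * n⌋₊ →
    ε / 2 * Fintype.card (Fin m → Fin k → Fin n × Bool) ≤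
    ((univ.filter fun Φ : Fin m → Fin k → Fin n × Bool =>
    (∀ v : Fin n, 1 ≤ |F n m Φ v|) ∧
    ∀ i : Fin m, ∃ j : Fin k, decide (0 ≤ F n m Φ (Φ i j).1) = (Φ i j).2).card : ℝ) :=
  fun k hk => shwK_kernelAt_of_hardAt (hH k hk)

/-- **Kernel ⇒ core, for large `k`.** Beyond Huang–Sellke's threshold `k₀` the kernel at `k`
implies the hardness conjunct `H k`: a poly-time `f` with success `> ε` frequently would be shadowed
by a saturated low-degree `F` sign-solving `≥ ε/2 · #Φ` instances frequently, while HS25 Cor. 3.21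
(`huangSellke2025KSat_holds`) caps that count by `ε/4 · #Φ` eventually; `#Φ ≥ 1` once `n ≥ 1`.
(The inner argument of `stub_lineAComposition`, at a fixed `k`.) [HuangSellke2025 = arXiv:2501.06427, Cor. 3.21] -/
theorem shwK_hardAt_of_kernelAt :
    ∃ k₀ : ℕ, ∀ k : ℕ, k₀ ≤ k →
      (∀ f : List Bool → List Bool, IsPolyTime f → ∀ ε : ℝ, 0 < ε →
        (∃ᶠ n : ℕ in atTop, ∀ m : ℕ, m = ⌊5 * 2 ^ k * Real.log k / k * n⌋₊ →
        ε * Fintype.card (Fin m → Fin k → Fin n × Bool) ≤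
        ((univ.filter fun Φ : Fin m → Fin k → Fin n × Bool => ∀ i, ∃ j,
        (f (encodingCNF.encode (List.ofFn fun a => List.ofFn fun b =>
        (((Φ a b).1 : ℕ), (Φ a b).2)))).getD (Φ i j).1 false = (Φ i j).2).card : ℝ)) →
        ∃ C : ℝ, 0 < C ∧ ∃ D : ℕ → ℕ, (fun n : ℕ => (D n : ℝ)) =o[atTop] (fun n : ℕ => (n : ℝ)) ∧
        ∃ F : (n : ℕ) → (m : ℕ) → (Fin m → Fin k → Fin n × Bool) → Fin n → ℝ,
        (∀ (n m : ℕ) (v : Fin n), IsCoordDegreeLE (D n)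
        (fun y : Fin m × Fin k → Fin n × Bool => F n m (Function.curry y) v)) ∧
        (∀ n m : ℕ, m = ⌊5 * 2 ^ k * Real.log k / k * n⌋₊ →
        ∑ Φ : Fin m → Fin k → Fin n × Bool, ∑ v : Fin n, F n m Φ v ^ 2
        ≤ C * n * Fintype.card (Fin m → Fin k → Fin n × Bool)) ∧
        ∃ᶠ n : ℕ in atTop, ∀ m : ℕ, m = ⌊5 * 2 ^ k * Real.log k / k * n⌋₊ →
        ε / 2 * Fintype.card (Fin m → Fin k → Fin n × Bool) ≤
        ((univ.filter fun Φ : Fin m → Fin k → Fin n × Bool =>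
        (∀ v : Fin n, 1 ≤ |F n m Φ v|) ∧
        ∀ i : Fin m, ∃ j : Fin k, decide (0 ≤ F n m Φ (Φ i j).1) = (Φ i j).2).card : ℝ)) →
      ∀ f : List Bool → List Bool, IsPolyTime f → ∀ ε : ℝ, 0 < ε →
      ∀ᶠ n : ℕ in atTop, ∀ m : ℕ, m = ⌊5 * 2 ^ k * Real.log k / k * n⌋₊ →
      ((univ.filter fun Φ : Fin m → Fin k → Fin n × Bool => ∀ i, ∃ j,
      (f (encodingCNF.encode (List.ofFn fun a => List.ofFn fun b =>
      (((Φ a b).1 : ℕ), (Φ a b).2)))).getD (Φ i j).1 false = (Φ i j).2).card : ℝ) /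
      Fintype.card (Fin m → Fin k → Fin n × Bool) ≤ ε := by
  obtain ⟨k₀, hLDH⟩ := huangSellke2025KSat_holds
  refine ⟨k₀, fun k hk hKER => ?_⟩
  intro f hf ε hε
  by_contra H
  -- frequent success `> ε`, as a count inequality
  have hfreq : ∃ᶠ n : ℕ in atTop, ∀ m : ℕ, m = ⌊5 * 2 ^ k * Real.log k / k * n⌋₊ →
      ε * Fintype.card (Fin m → Fin k → Fin n × Bool) ≤
        ((univ.filter fun Φ : Fin m → Fin k → Fin n × Bool => ∀ i, ∃ j,
            (f (encodingCNF.encode (List.ofFn fun a => List.ofFn fun b =>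
              (((Φ a b).1 : ℕ), (Φ a b).2)))).getD (Φ i j).1 false = (Φ i j).2).card : ℝ) := by
    rw [Filter.not_eventually] at H
    refine H.mono fun n hn => ?_
    intro m hm
    rw [Classical.not_forall] at hn
    obtain ⟨m', hm'⟩ := hn
    rw [Classical.not_imp, not_le] at hm'
    obtain ⟨hm'eq, hlt⟩ := hm'
    subst hm; subst hm'eq
    set N := (Fintype.card (Fin ⌊5 * 2 ^ k * Real.log k / k * n⌋₊ → Fin k → Fin n × Bool) : ℝ)
    have hNpos : 0 < N := by
      rcases lt_or_ge 0 N with h | h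
      · exact h
      · have hN0 : N = 0 := le_antisymm h (Nat.cast_nonneg _)
        rw [hN0, div_zero] at hlt
        exact absurd hlt (not_lt.2 hε.le)
    exact le_of_lt ((lt_div_iff₀ hNpos).1 hlt)
  obtain ⟨C, hC, D, hD, F, hdeg, hener, hFfreq⟩ := hKER f hf ε hε hfreq
  have hev := hLDH k hk C hC D hD F hdeg hener (ε / 4) (by positivity)
  obtain ⟨n, hn₁, hn₂, hn₃⟩ := (hFfreq.and_eventually (hev.and (eventually_ge_atTop 1))).exists
  have h₁ := hn₁ _ rfl
  have h₂ := hn₂ _ rfl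
  have hcard := shw_one_le_card_litArray (m := ⌊5 * 2 ^ k * Real.log k / k * n⌋₊) (k := k) hn₃
  have : ε / 2 * (Fintype.card (Fin ⌊5 * 2 ^ k * Real.log k / k * n⌋₊ → Fin k → Fin n × Bool) : ℝ)
      ≤ ε / 4 * Fintype.card (Fin ⌊5 * 2 ^ k * Real.log k / k * n⌋₊ → Fin k → Fin n × Bool) :=
    h₁.trans h₂
  nlinarith

/-- **The kernel IS the core (for all large `k`).** There is `k₀` such that for every `k ≥ k₀` the
kernel of line `Sketch` at `k` is EQUIVALENT to the crux's hardness conjunct at `(k, α_k)`; since the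
latter for a single `k ≥ 1024` gives `SearchHardWindow` (`searchHardWindow_of_hard_at_window`) and
`SearchHardWindow → PneNP`, the one open stub of the line is exactly as hard as the crux.
[HuangSellke2025 = arXiv:2501.06427, Cor. 3.21; BreslerHuang2022 = arXiv:2106.02129, Conj. 2.7] -/
theorem shwK_kernelAt_iff_hardAt :
    ∃ k₀ : ℕ, ∀ k : ℕ, k₀ ≤ k →
      ((∀ f : List Bool → List Bool, IsPolyTime f → ∀ ε : ℝ, 0 < ε →
        (∃ᶠ n : ℕ in atTop, ∀ m : ℕ, m = ⌊5 * 2 ^ k * Real.log k / k * n⌋₊ →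
        ε * Fintype.card (Fin m → Fin k → Fin n × Bool) ≤
        ((univ.filter fun Φ : Fin m → Fin k → Fin n × Bool => ∀ i, ∃ j,
        (f (encodingCNF.encode (List.ofFn fun a => List.ofFn fun b =>
        (((Φ a b).1 : ℕ), (Φ a b).2)))).getD (Φ i j).1 false = (Φ i j).2).card : ℝ)) →
        ∃ C : ℝ, 0 < C ∧ ∃ D : ℕ → ℕ, (fun n : ℕ => (D n : ℝ)) =o[atTop] (fun n : ℕ => (n : ℝ)) ∧
        ∃ F : (n : ℕ) → (m : ℕ) → (Fin m → Fin k → Fin n × Bool) → Fin n → ℝ,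
        (∀ (n m : ℕ) (v : Fin n), IsCoordDegreeLE (D n)
        (fun y : Fin m × Fin k → Fin n × Bool => F n m (Function.curry y) v)) ∧
        (∀ n m : ℕ, m = ⌊5 * 2 ^ k * Real.log k / k * n⌋₊ →
        ∑ Φ : Fin m → Fin k → Fin n × Bool, ∑ v : Fin n, F n m Φ v ^ 2
        ≤ C * n * Fintype.card (Fin m → Fin k → Fin n × Bool)) ∧
        ∃ᶠ n : ℕ in atTop, ∀ m : ℕ, m = ⌊5 * 2 ^ k * Real.log k / k * n⌋₊ →
        ε / 2 * Fintype.card (Fin m → Fin k → Fin n × Bool) ≤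
        ((univ.filter fun Φ : Fin m → Fin k → Fin n × Bool =>
        (∀ v : Fin n, 1 ≤ |F n m Φ v|) ∧
        ∀ i : Fin m, ∃ j : Fin k, decide (0 ≤ F n m Φ (Φ i j).1) = (Φ i j).2).card : ℝ)) ↔
      ∀ f : List Bool → List Bool, IsPolyTime f → ∀ ε : ℝ, 0 < ε →
      ∀ᶠ n : ℕ in atTop, ∀ m : ℕ, m = ⌊5 * 2 ^ k * Real.log k / k * n⌋₊ →
      ((univ.filter fun Φ : Fin m → Fin k → Fin n × Bool => ∀ i, ∃ j,
      (f (encodingCNF.encode (List.ofFn fun a => List.ofFn fun b =>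
      (((Φ a b).1 : ℕ), (Φ a b).2)))).getD (Φ i j).1 false = (Φ i j).2).card : ℝ) /
      Fintype.card (Fin m → Fin k → Fin n × Bool) ≤ ε) := by
  obtain ⟨k₀, h⟩ := shwK_hardAt_of_kernelAt
  exact ⟨k₀, fun k hk => ⟨h k hk, shwK_kernelAt_of_hardAt⟩⟩

end Summit.PneNP.PneNP.Theorems

end
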